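import Summits.QuantumFields.BalabanUV.Beta.D1BFx.RestKernelSandwichSlot
import Summits.QuantumFields.BalabanUV.Beta.D1BFx.RestKernelBlockSlot
import Summits.QuantumFields.BalabanUV.Beta.D1BFx.RestKernelFPSlot
import Summits.QuantumFields.BalabanUV.Beta.D1BFx.RestKernelGhostSlotJ
import Summits.QuantumFields.BalabanUV.Beta.D1BFx.RestKernelSlotGlue
import Summits.QuantumFields.BalabanUV.Beta.D1BFx.PackedNSidePair

/-!
# `BalabanUV.Beta.D1BFx.PackedRoadRestFamily` — road «BF-x» for binder row D1, slot (K): PART 12a «THE ROAD's REST-WORD MEMBER FAMILY» —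
# **the road's per-scale jets, TOTAL in the block size, and `RkRoad := Sum.elim` of the lanes' SLOT PACKs at those jets; its pointwise sum IS the six
# rest words of PART 10 ∕ PART 11's packing row `hRk`** (definition lane: six [our object] data definitions + [folklore] unfoldings; asserts nothing).

The END `RoadEndBFxDictPointwiseS` ∕ PART 11 `RoadEndBFxJunctionsS.d1Rep_BFx_of_junctions_sbpS` take the rest words as ONE member family
`Rk : υ → ℕ → Fin 4 → Fin 4 → Site 4 → ℝ`, TOTAL in the block size `n`, with the packing row `hRk : Σ_u Rk u (Lc^m) μ ν z = (the six words)`.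
The lanes supply member families generic in per-scale jets (leaf-01: «SANDWICH SLOT PACK» `RkSand a 𝒱 𝒲`, «BLOCK SLOT PACK» `RkBlk a 𝒱 𝒲`,
«FP SLOT PACK» `RkFP 𝓻 𝓌`, «GHOST SLOT PACK J» `RkGhJ ω a 𝒱gh 𝒲gh`; glue `RestKernelSlotGlue`).  This file names the ROAD's jets as families in `n` by
pattern matching (`0 ↦ 0`, `m+1 ↦` PART 8's object at block size `m+1` — so every `…_succ` unfolding is `rfl` and reads `SN m a (S (m+1))`,
`W2NInf m a (r (m+1)) (S₂ (m+1))`, `NlegRoad m a` LITERALLY):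
* §1 `wroad r` (the columns `colH G₀ n` of the gauged resolvent `G₀ := coDressKBmAt (toSite (r n)) n (KInvStep n 0)`), `Vroad a r S` (`vertexOfK G₀ n (SN (n−1) a (S n))`),
  `Wroad a r S₂` (`W2NInf (n−1) a (r n) (S₂ n)`), `Vgh r` ∕ `Wgh r` (the `n²`-rescaled `colH G₀`-packed ghost jets of PART 7∕10);
* §2 `RoadIdx`, **`RkRoad a r S S₂ RJ2 RJ3 := Sum.elim (RkSand …) (Sum.elim (RkBlk …) (Sum.elim (RkFP r (wroad r)) (Sum.elim RJ₂ (Sum.elim RJ₃ (RkGhJ 1 a (Vgh r) (Wgh r))))))`**;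
* §3 **`sum_RkRoad_succ`** ∕ **`sum_RkRoad_of_neZero`**: `Σ_u RkRoad … u n μ ν z` = PART 10's six words at `n = m+1` ∕ at any `[NeZero n]` (the `hRk` row of PART 11,
  token for token at `n := Lc^m`).
HONEST: [our object] data definitions + [folklore] `Sum.elim` ∕ pattern-matching bookkeeping BY NAME; no row, no estimate, nothing of Bałaban's; 0 root-level
binders of row D1 discharged; (K) NOT closed; NOT D1, NOT `BetaPertH`, NOT continuum, NOT Clay.  No `def … : Prop`, nothing cited, 0 sorry.
HONEST DEPENDENCY: continuum YM on T⁴ ⇐ BetaPertH ∧ nine spine estimates (0/9 proved); BetaPertH ⇐ (D1) ∧ (D4) ∧ CAP+tail; G-an2-4 gates asym, D1 and NE2/3/4.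
ABSOLUTE RULE (cell charter, verbatim): «No internally-minted statement may enter as a cited fact. Every hypothesis is either kernel-proved in this
package or a verbatim quotation of a PUBLISHED theorem with page reference. The manuscript(s) under audit are NOT citable for their own disputed
steps — they are the thing under adjudication; programme-internal (2001/route/tribunal) claims are never citable.»
Unit `b2b-balaban-beta-d1-p2` (road owner, gen 19), 2026-08-22.
-/

noncomputable section

namespace Summit.QuantumFields.BalabanUV.Beta.D1BFx.PackedRoadRestFamily

open scoped BigOperators
open Literature.MathematicalPhysics.QuantumFieldTheory.Balaban1983to89
open Literature.MathematicalPhysics.QuantumFieldTheory.Balaban1983to89.Beta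
open ExpKernelCalculus (Site MKer hessKer)
open AffineAveraging (toSite)
open OneStepResolventKernel (Fib wsum)
open OneStepKernelFamily (KInvStep colH vertexOfK)
open Summit.QuantumFields.BalabanUV.Beta.AxialDressingRooted (coDressKBmAt)
open Summit.QuantumFields.BalabanUV.Beta.D1BFx.PackedKernelSplit (blk ffV ffW legCross blockTerms)
open Summit.QuantumFields.BalabanUV.Beta.D1BFx.CoarseGramInverse (multM)
open Summit.QuantumFields.BalabanUV.Beta.D1BFx.RWeightedLegPack (NlegRoad sandP)
open Summit.QuantumFields.BalabanUV.Beta.D1BFx.GluonLeg (Ga)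
open Summit.QuantumFields.BalabanUV.Beta.D1BFx.GaugeJetLocal (idK1)
open Summit.QuantumFields.BalabanUV.Beta.D1BFx.CombFPWordArrays (nFcol)
open Summit.QuantumFields.BalabanUV.Beta.D1BFx.GhostStencil (ghCur)
open Summit.QuantumFields.BalabanUV.Beta.D1BFx.TorusGhostPairStencils (gh₂)
open Summit.QuantumFields.BalabanUV.Beta.D1BFx.GhostLeg (Ggh)
open Summit.QuantumFields.BalabanUV.Beta.D1BFx.RProjector (Pgt)
open Summit.QuantumFields.BalabanUV.Beta.D1BFx.RestKernelGhostWords (GhIdx ghostWordK)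
open Summit.QuantumFields.BalabanUV.Beta.D1BFx.PackedNSideDictionary (SN)
open Summit.QuantumFields.BalabanUV.Beta.D1BFx.PackedNSidePair (W2NInf)
open Summit.QuantumFields.BalabanUV.Beta.D1BFx.RestKernelSandwichSlot (RkSand sum_RkSand_succ)
open Summit.QuantumFields.BalabanUV.Beta.D1BFx.RestKernelBlockSlot (RkBlk sum_RkBlk_succ)
open Summit.QuantumFields.BalabanUV.Beta.D1BFx.RestKernelFPSlot (RkFP sum_RkFP_succ)
open Summit.QuantumFields.BalabanUV.Beta.D1BFx.RestKernelGhostSlotJ (RkGhJ sum_RkGhJ_succ_one)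
open Summit.QuantumFields.BalabanUV.Beta.D1BFx.RestKernelSlotGlue (sum_elim_pointwise)

/-! ## §1 The road's per-scale jets, TOTAL in the block size -/

section Jets

variable (a : ℝ) (r : ℕ → Fin 4 → ℕ) (S : ℕ → Fin 4 → (Fin 4 → ℤ) → MKer 4 (Fib 3))
  (S₂ : ℕ → Fin 4 → (Fin 4 → ℤ) → Fin 4 → (Fin 4 → ℤ) → MKer 4 (Fib 3))

/-- [our object] **THE ROAD's FIRST-WEIGHT FAMILY** `wroad r n := colH G₀ n` (the `ℋ`-columns of the gauged resolvent `G₀ := coDressKBmAt (toSite (r n)) n (KInvStep n 0)`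
at block size `n`), `0` at the junk block size `n = 0`.  A DEFINITION; asserts nothing. -/
def wroad : ℕ → Fin 4 → (Fin 4 → ℤ) → Fin 4 → (Fin 4 → ℤ) → ℝ
  | 0 => fun _ _ _ _ => 0
  | m + 1 => colH (coDressKBmAt (toSite (r (m + 1))) (m + 1) (KInvStep (d := 3) (m + 1) 0)) (m + 1)

/-- [our object] **THE ROAD's PACKED FIRST JETS** `Vroad a r S n := vertexOfK G₀ n (SN (n−1) a (S n))` (PART 4∕8's N-side first-derivative pack at the gauged
resolvent), `0` at `n = 0`.  A DEFINITION. -/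
def Vroad : ℕ → Fin 4 → Site 4 → MKer 4 (Fib 3)
  | 0 => fun _ _ => 0
  | m + 1 => vertexOfK (coDressKBmAt (toSite (r (m + 1))) (m + 1) (KInvStep (d := 3) (m + 1) 0)) (m + 1) (SN m a (S (m + 1)))

/-- [our object] **THE ROAD's PACKED SECOND TABLES** `Wroad a r S₂ n := W2NInf (n−1) a (r n) (S₂ n)` ((D) PART II's explicit N-side second family), `0` at `n = 0`.
A DEFINITION. -/
def Wroad : ℕ → Fin 4 → Site 4 → Fin 4 → Site 4 → MKer 4 (Fib 3)
  | 0 => fun _ _ _ _ => 0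
  | m + 1 => W2NInf m a (r (m + 1)) (S₂ (m + 1))

/-- [our object] **THE ROAD's RESCALED GHOST FIRST JETS** `Vgh r n κ′ v := n² • 𝒢[colH G₀ n κ′ v]` (PART 7's `𝒱gh`), `0` at `n = 0`.  A DEFINITION. -/
def Vgh : ℕ → Fin 4 → Site 4 → MKer 4 Unit
  | 0 => fun _ _ => 0
  | m + 1 => fun κ' v => (((m + 1 : ℕ) : ℝ) ^ 2) • (fun x y a b => ∑ κ : Fin 4,
      wsum (colH (coDressKBmAt (toSite (r (m + 1))) (m + 1) (KInvStep (d := 3) (m + 1) 0)) (m + 1) κ' v κ) (ghCur κ) x y a b)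

/-- [our object] **THE ROAD's RESCALED GHOST SECOND JETS** `Wgh r n κ′ v l v′ := n² • 𝒟[colH G₀ n]` (PART 7's `𝒲gh`), `0` at `n = 0`.  A DEFINITION. -/
def Wgh : ℕ → Fin 4 → Site 4 → Fin 4 → Site 4 → MKer 4 Unit
  | 0 => fun _ _ _ _ => 0
  | m + 1 => fun κ' v l v' => (((m + 1 : ℕ) : ℝ) ^ 2) • (fun x y a b => ∑ κ : Fin 4,
      wsum (colH (coDressKBmAt (toSite (r (m + 1))) (m + 1) (KInvStep (d := 3) (m + 1) 0)) (m + 1) κ' v κ)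
        (fun u => fun x y a b => colH (coDressKBmAt (toSite (r (m + 1))) (m + 1) (KInvStep (d := 3) (m + 1) 0)) (m + 1) l v' κ u * gh₂ κ u x y a b) x y a b)

/-- [our object] Unfolding at `n = m + 1` (`rfl`). -/
theorem wroad_succ (m : ℕ) : wroad r (m + 1) = colH (coDressKBmAt (toSite (r (m + 1))) (m + 1) (KInvStep (d := 3) (m + 1) 0)) (m + 1) := rfl

/-- [our object] Unfolding at `n = m + 1` (`rfl`). -/
theorem Vroad_succ (m : ℕ) :
    Vroad a r S (m + 1) = vertexOfK (coDressKBmAt (toSite (r (m + 1))) (m + 1) (KInvStep (d := 3) (m + 1) 0)) (m + 1) (SN m a (S (m + 1))) := rfl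

/-- [our object] Unfolding at `n = m + 1` (`rfl`). -/
theorem Wroad_succ (m : ℕ) : Wroad a r S₂ (m + 1) = W2NInf m a (r (m + 1)) (S₂ (m + 1)) := rfl

/-- [our object] Unfolding at `n = m + 1` (`rfl`). -/
theorem Vgh_succ (m : ℕ) : Vgh r (m + 1) = fun κ' v => (((m + 1 : ℕ) : ℝ) ^ 2) • (fun x y a b => ∑ κ : Fin 4,
      wsum (colH (coDressKBmAt (toSite (r (m + 1))) (m + 1) (KInvStep (d := 3) (m + 1) 0)) (m + 1) κ' v κ) (ghCur κ) x y a b) := rfl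

/-- [our object] Unfolding at `n = m + 1` (`rfl`). -/
theorem Wgh_succ (m : ℕ) : Wgh r (m + 1) = fun κ' v l v' => (((m + 1 : ℕ) : ℝ) ^ 2) • (fun x y a b => ∑ κ : Fin 4,
      wsum (colH (coDressKBmAt (toSite (r (m + 1))) (m + 1) (KInvStep (d := 3) (m + 1) 0)) (m + 1) κ' v κ)
        (fun u => fun x y a b => colH (coDressKBmAt (toSite (r (m + 1))) (m + 1) (KInvStep (d := 3) (m + 1) 0)) (m + 1) l v' κ u * gh₂ κ u x y a b) x y a b) := rfl

/-- [our object] The first weights ARE leaf-04's `dite`-spelled family (`RestKernelFPSlotRoad`'s `𝓌_{G₀}`): the `NeZero` instance manufactured from `n ≠ 0` is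
proof-irrelevant. -/
theorem wroad_eq_dite : wroad r = fun n κ' v κ u =>
    if h : n = 0 then 0 else colH (coDressKBmAt (toSite (r n)) n (@KInvStep 3 n ⟨h⟩ 0)) n κ' v κ u := by
  funext n κ' v κ u
  cases n with
  | zero => simp [wroad]
  | succ m => rw [dif_neg (Nat.succ_ne_zero m)]; rfl

end Jets

/-! ## §2 The road's member family -/

/-- [our object] The road's rest-word index: sandwich ⊕ (block ⊕ (comb-FP ⊕ ((J2) rest ⊕ ((J3) rest ⊕ ghost)))). -/
abbrev RoadIdx : Type := (Unit ⊕ (Bool × Bool)) ⊕ (((Bool × Bool) ⊕ (Bool × Bool × Bool × Bool)) ⊕ (Unit ⊕ (Unit ⊕ (Unit ⊕ GhIdx))))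

variable (a : ℝ) (r : ℕ → Fin 4 → ℕ) (S : ℕ → Fin 4 → (Fin 4 → ℤ) → MKer 4 (Fib 3))
  (S₂ : ℕ → Fin 4 → (Fin 4 → ℤ) → Fin 4 → (Fin 4 → ℤ) → MKer 4 (Fib 3)) (RJ2 RJ3 : ℕ → Fin 4 → Fin 4 → Site 4 → ℝ)

/-- [our object] **THE ROAD's REST-WORD MEMBER FAMILY** `RkRoad a r S S₂ RJ2 RJ3 : RoadIdx → ℕ → Fin 4 → Fin 4 → Site 4 → ℝ` — `Sum.elim` of the lanes' SLOT PACKs at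
the road's jets: sandwich `RkSand a (Vroad a r S) (Wroad a r S₂)`, block `RkBlk a (Vroad a r S) (Wroad a r S₂)`, comb-FP `RkFP r (wroad r)`, the junction rests
`RJ2`∕`RJ3` as singleton members, ghost `RkGhJ (fun _ => 1) a (Vgh r) (Wgh r)`.  A DEFINITION; asserts nothing. -/
def RkRoad : RoadIdx → ℕ → Fin 4 → Fin 4 → Site 4 → ℝ :=
  Sum.elim (RkSand a (Vroad a r S) (Wroad a r S₂))
    (Sum.elim (RkBlk a (Vroad a r S) (Wroad a r S₂))
      (Sum.elim (RkFP r (wroad r))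
        (Sum.elim (fun _ : Unit => RJ2) (Sum.elim (fun _ : Unit => RJ3) (RkGhJ (fun _ => (1 : ℝ)) a (Vgh r) (Wgh r))))))

/-- [our object] Unfolding `RkRoad`. -/
theorem RkRoad_eq : RkRoad a r S S₂ RJ2 RJ3 = Sum.elim (RkSand a (Vroad a r S) (Wroad a r S₂))
    (Sum.elim (RkBlk a (Vroad a r S) (Wroad a r S₂))
      (Sum.elim (RkFP r (wroad r))
        (Sum.elim (fun _ : Unit => RJ2) (Sum.elim (fun _ : Unit => RJ3) (RkGhJ (fun _ => (1 : ℝ)) a (Vgh r) (Wgh r)))))) := rfl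

/-! ## §3 The pointwise sum: PART 10's six rest words -/

/-- [folklore] **THE ROAD FAMILY's POINTWISE SUM AT `n = m + 1` IS PART 10's SIX REST WORDS**, token for token at `r (m+1)`, `S (m+1)`, `S₂ (m+1)`
(glue `sum_elim_pointwise` ×5 + the packs' `sum_…_succ` + the `rfl` unfoldings of §1). -/
theorem sum_RkRoad_succ (m : ℕ) (μ ν : Fin 4) (z : Site 4) :
    ∑ u, RkRoad a r S S₂ RJ2 RJ3 u (m + 1) μ ν z =
        (legCross ((2 : ℝ)⁻¹ • Ga (m + 1) a)
            ((-(2 : ℝ)⁻¹) • blk (sandP (m + 1) (Ga (m + 1) a) (multM (m + 1) (2 * a / ((m + 1 : ℕ) : ℝ) ^ 8) 2)) true true)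
            (ffV (vertexOfK (coDressKBmAt (toSite (r (m + 1))) (m + 1) (KInvStep (d := 3) (m + 1) 0)) (m + 1) (SN m a (S (m + 1))))) (ffW (W2NInf m a (r (m + 1)) (S₂ (m + 1)))) μ ν z
          + blockTerms (NlegRoad m a) (vertexOfK (coDressKBmAt (toSite (r (m + 1))) (m + 1) (KInvStep (d := 3) (m + 1) 0)) (m + 1) (SN m a (S (m + 1)))) (W2NInf m a (r (m + 1)) (S₂ (m + 1))) μ ν z
          + 2 * hessKer idK1
          (fun κ' v => fun x y c b => ∑ κ : Fin 4, wsum (colH (coDressKBmAt (toSite (r (m + 1))) (m + 1) (KInvStep (d := 3) (m + 1) 0)) (m + 1) κ' v κ) (nFcol (r (m + 1)) (m + 1) κ) x y c b)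
          (fun κ' v l v' => fun x y c b => ∑ κ : Fin 4, wsum (colH (coDressKBmAt (toSite (r (m + 1))) (m + 1) (KInvStep (d := 3) (m + 1) 0)) (m + 1) κ' v κ)
            (fun u => fun x y c b => colH (coDressKBmAt (toSite (r (m + 1))) (m + 1) (KInvStep (d := 3) (m + 1) 0)) (m + 1) l v' κ u * nFcol (r (m + 1)) (m + 1) κ u x y c b) x y c b)
          μ ν z
          + RJ2 (m + 1) μ ν z + RJ3 (m + 1) μ ν z
          + ∑ i : GhIdx, ghostWordK (Ggh (m + 1) a) (Pgt (m + 1) a)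
              (fun κ' v => (((m + 1 : ℕ) : ℝ) ^ 2) • (fun x y a b => ∑ κ : Fin 4,
                wsum (colH (coDressKBmAt (toSite (r (m + 1))) (m + 1) (KInvStep (d := 3) (m + 1) 0)) (m + 1) κ' v κ) (ghCur κ) x y a b))
              (fun κ' v l v' => (((m + 1 : ℕ) : ℝ) ^ 2) • (fun x y a b => ∑ κ : Fin 4,
                wsum (colH (coDressKBmAt (toSite (r (m + 1))) (m + 1) (KInvStep (d := 3) (m + 1) 0)) (m + 1) κ' v κ)
                  (fun u => fun x y a b => colH (coDressKBmAt (toSite (r (m + 1))) (m + 1) (KInvStep (d := 3) (m + 1) 0)) (m + 1) l v' κ u * gh₂ κ u x y a b) x y a b))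
              i μ ν z) := by
  rw [RkRoad_eq, sum_elim_pointwise, sum_elim_pointwise, sum_elim_pointwise, sum_elim_pointwise, sum_elim_pointwise, sum_RkSand_succ, sum_RkBlk_succ,
    sum_RkFP_succ, sum_RkGhJ_succ_one, Fintype.sum_unique, Fintype.sum_unique]
  simp only [Vroad_succ, Wroad_succ, wroad_succ, Vgh_succ, Wgh_succ]
  ring

/-- [folklore] **… AND AT ANY `[NeZero n]`**, with the N-side objects read at `n − 1` — PART 11's packing row `hRk` at `n := Lc^m`, token for token. -/
theorem sum_RkRoad_of_neZero (n : ℕ) [NeZero n] (μ ν : Fin 4) (z : Site 4) :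
    ∑ u, RkRoad a r S S₂ RJ2 RJ3 u n μ ν z =
        (legCross ((2 : ℝ)⁻¹ • Ga n a)
            ((-(2 : ℝ)⁻¹) • blk (sandP n (Ga n a) (multM n (2 * a / ((n : ℕ) : ℝ) ^ 8) 2)) true true)
            (ffV (vertexOfK (coDressKBmAt (toSite (r n)) n (KInvStep (d := 3) n 0)) n (SN (n - 1) a (S n)))) (ffW (W2NInf (n - 1) a (r n) (S₂ n))) μ ν z
          + blockTerms (NlegRoad (n - 1) a) (vertexOfK (coDressKBmAt (toSite (r n)) n (KInvStep (d := 3) n 0)) n (SN (n - 1) a (S n))) (W2NInf (n - 1) a (r n) (S₂ n)) μ ν z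
          + 2 * hessKer idK1
          (fun κ' v => fun x y c b => ∑ κ : Fin 4, wsum (colH (coDressKBmAt (toSite (r n)) n (KInvStep (d := 3) n 0)) n κ' v κ) (nFcol (r n) n κ) x y c b)
          (fun κ' v l v' => fun x y c b => ∑ κ : Fin 4, wsum (colH (coDressKBmAt (toSite (r n)) n (KInvStep (d := 3) n 0)) n κ' v κ)
            (fun u => fun x y c b => colH (coDressKBmAt (toSite (r n)) n (KInvStep (d := 3) n 0)) n l v' κ u * nFcol (r n) n κ u x y c b) x y c b)
          μ ν z
          + RJ2 n μ ν z + RJ3 n μ ν z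
          + ∑ i : GhIdx, ghostWordK (Ggh n a) (Pgt n a)
              (fun κ' v => (((n : ℕ) : ℝ) ^ 2) • (fun x y a b => ∑ κ : Fin 4,
                wsum (colH (coDressKBmAt (toSite (r n)) n (KInvStep (d := 3) n 0)) n κ' v κ) (ghCur κ) x y a b))
              (fun κ' v l v' => (((n : ℕ) : ℝ) ^ 2) • (fun x y a b => ∑ κ : Fin 4,
                wsum (colH (coDressKBmAt (toSite (r n)) n (KInvStep (d := 3) n 0)) n κ' v κ)
                  (fun u => fun x y a b => colH (coDressKBmAt (toSite (r n)) n (KInvStep (d := 3) n 0)) n l v' κ u * gh₂ κ u x y a b) x y a b))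
              i μ ν z) := by
  obtain ⟨m, rfl⟩ : ∃ m, n = m + 1 := ⟨n - 1, (Nat.succ_pred_eq_of_ne_zero (NeZero.ne n)).symm⟩
  rw [Nat.add_sub_cancel]
  exact sum_RkRoad_succ a r S S₂ RJ2 RJ3 m μ ν z

end Summit.QuantumFields.BalabanUV.Beta.D1BFx.PackedRoadRestFamily

end
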